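import Summits.QuantumFields.BalabanUV.Beta.EriceRemainderEnclosureHistoryAutonomyComparisonAgeCompositionOldBlockCap
import Summits.QuantumFields.BalabanUV.Beta.EriceRemainderEnclosureHistoryAutonomyComparisonAgeCompositionTwoClusterLevels

/-!
# EriceRemainderEnclosureHistoryAutonomyComparisonAgeCompositionOldBlockYoungestGap — (E100d) route (N), first order: DENSE OLD OCTAVES AS LEVELS OF
# THE SHARP-LAST-STEP ENGINES.  (E100c) put arbitrary finite sets of ages inside one old octave (`T_j ⊂ [a_j, p_j]`, `p_j ≤ 2a_j`, cap `5∕8` by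
# (E100b) `old_block_load_le`) into the ×R chain engine (E99c).  This file does the same for the two engines whose youngest step is sharp:
# (E99e) `flow_nonneg_cluster_levels_of_caps_youngest` — **`flow_nonneg_old_block_levels_of_cap_youngest`** (parametric: block cap `(s, Fm)`, youngest
# cluster and closures as hypotheses) and **`flow_nonneg_young_age_gap_old_blocks`**: ANY young age `a₀ ≥ 1` at ratio `31` below a
# ×64 chain of old octaves (`κ = 1∕5`, `s₀ = 0.7072`, `s = 5∕8`, `ρ₀ = 31`: `0.7072·(31·0.25 + 3.2) = 7.74384 ≤ 7.75`; the pair version (E99f) has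
# `30` and ×61) — and (E99g) `flow_nonneg_two_cluster_levels_of_caps` (two levels, only the last-step closure `s₀(ρ₀λ + 4s(1+κ) + κ) ≤ ρ₀λ`,
# `λ = 1 − s(1+κ)`, any `κ > 0`; limit `ρ₀ ≥ 4s·s₀∕((1−s)(1−s₀))` = `33.3` ∕ `16.1` for `s₀ = 0.8333` ∕ `0.7072` at `s = 5∕8`):
# **`flow_nonneg_census_young_pair_one_old_block`** (the census young pair `{1, k₂}`, `2 ≤ k₂ ≤ 29`, below ONE old octave at gap `34k₂ ≤ a`;
# `κ = 1∕1000`, `ρ₀ = 34`: `12.69304 ≤ 12.72875`) and **`flow_nonneg_young_age_one_old_block`** (any young age below ONE old octave at gap `17a₀ ≤ a`,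
# `56 ≤ a`; `ρ₀ = 17`: `6.27136 ≤ 6.364375`).

Cell `pub-balaban`, β-function sub-cell, BINDER row D4 «RemainderConst leaves for Bałaban's split» (`HOME/BINDER-OWNERS.md`; owner lineage `b2b-balaban-beta-an4`;
this file by co-owner #2 lineage `b2b-balaban-beta-d4-p2`, generation 88), β-FLOW TEAM duty (1), FREEZE (0) honoured (def-free; nothing restated).

HONEST FRAMING (page 1, verbatim and binding).  *"Discharging BetaPertH makes Bałaban's UV stability UNCONDITIONAL — a real constructive-QFT result; it is
NOT the continuum limit and NOT the Clay problem."*  THIS FILE DISCHARGES NOTHING OF THE KIND.  Elementary real algebra ∕ real analysis about ABSTRACT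
functionals on a box ]0,γ]^ℕ with displayed floors, profiles and signs, and the FIRST-ORDER renewal objects of route (N) built from them — hypotheses of a
census, not facts; the form, signs, ages and moments of Bałaban's (1.22) limit functional are NOT PRINTED ([I] p. 298; GAPS G-t4-U2-1∕-2) and NOT asserted.
Row D4 class UNCHANGED (critical-path width 0; instance 0∕1; D4 DISCHARGE NO DATE).  HONEST DEPENDENCY: continuum YM on T⁴ ⇐ BetaPertH ∧ nine spine
estimates (0/9 proved); BetaPertH ⇐ (D1) ∧ (D4) ∧ CAP+tail; G-an2-4 gates asym, D1 and NE2/3/4.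

THE POINT (README `HOME/b2b-balaban-beta-d4-p2/g88/README.md` §3).  Uses (E99e) `flow_nonneg_cluster_levels_of_caps_youngest`, (E99g)
`flow_nonneg_two_cluster_levels_of_caps`, (E100b) `old_block_load_le`, (E97c) `young_pair_load_le`, (E94b) `load_le_of_sq` BY NAME.  NOT CLAIMED: octaves
wider than `p ≤ 2a`; the young pair with `k₂ ≥ 30` under one octave (cap rows untyped); anything printed — NOT B12 Thm 2, NOT BetaPertH, NOT continuum,
NOT Clay.

WHAT IS PROVED ([folklore]; 0 `def`, 0 sorry).  §1 **`flow_nonneg_old_block_levels_of_cap_youngest`** (parametric).  §2 **`flow_nonneg_young_age_gap_old_blocks`**.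
§3 **`flow_nonneg_census_young_pair_one_old_block`**, **`flow_nonneg_young_age_one_old_block`**.
-/
noncomputable section
open Finset

namespace Summit.QuantumFields.BalabanUV.Beta.EriceRemainderEnclosureHistoryAutonomyComparisonAgeCompositionOldBlockYoungestGap

open Literature.MathematicalPhysics.QuantumFieldTheory.Balaban1983to89
open Literature.MathematicalPhysics.QuantumFieldTheory.Balaban1983to89.T4BetaStationary
open Literature.MathematicalPhysics.QuantumFieldTheory.Balaban1983to89.T4BetaFlowWellPosed
open Summit.QuantumFields.BalabanUV.Beta.EriceRemainderEnclosureHistoryAutonomyComparisonAgeCompositionYoungPairMoment (load_le_of_sq)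
open Summit.QuantumFields.BalabanUV.Beta.EriceRemainderEnclosureHistoryAutonomyComparisonAgeCompositionOldBlockCap (old_block_load_le)
open Summit.QuantumFields.BalabanUV.Beta.EriceRemainderEnclosureHistoryAutonomyComparisonAgeCompositionClusterLevelsYoungest
  (flow_nonneg_cluster_levels_of_caps_youngest)
open Summit.QuantumFields.BalabanUV.Beta.EriceRemainderEnclosureHistoryAutonomyComparisonAgeCompositionTwoClusterLevels
  (flow_nonneg_two_cluster_levels_of_caps)
open Summit.QuantumFields.BalabanUV.Beta.EriceRemainderEnclosureHistoryAutonomyComparisonAgeCompositionYoungPairCapSeparatedAges (young_pair_load_le)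

variable {B : (ℕ → ℝ) → ℝ} {γ b gIR : ℝ} {L : ℕ → ℝ} {K : ℕ} {h g : ℕ → ℝ}

/-! ## §1 Old blocks above any capped youngest cluster, sharp youngest gap (parametric) -/

/-- **OLD BLOCKS AS LEVELS OF THE SHARP-YOUNGEST-GAP ENGINE (parametric).**  As (E100c) `flow_nonneg_old_block_levels_of_cap` but through (E99e)
`flow_nonneg_cluster_levels_of_caps_youngest`: a BLOCK CAP `(s, Fm)` as hypothesis (every finite set of ages inside `[lo, hi]`, `56 ≤ lo`, `hi ≤ Fm·lo`,
`hi < K`, carries `≤ s`) together with `3 < 8s²`, `3ρ₀ + 1 ≤ 8ρ₀s²` (so that ONE age `k ≥ ρ₀` alone carries `≤ s`, (E94b) `load_le_of_sq` — a level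
`T j ⊂ [a j, a j]` needs no `56 ≤ a j`); a youngest cluster `S₀ ⊂ [1, K)` with window `hi₀ ≥ 1` and cap `s₀`; older levels `T j ⊂ [a j, p j]` finite and
arbitrary, `a j ≤ p j ≤ Fm·a j` with `56 ≤ a j` whenever `a j < p j`, `p j < K`; YOUNGEST GAP `ρ₀·hi₀ ≤ a 1` and separations `R₀·p j ≤ a (j+1)` with
`ρ₀ ≤ R₀`; the profile vanishes off `S₀ ∪ ⋃ T j`.  CLOSURE `κ > 0`, `0 ≤ s`, `s(1+κ) < 1`, `κ + 4s(1+κ) ≤ R₀(1 − s(1+κ))κ`, `2 ≤ ρ₀`,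
`s₀(ρ₀(1 − s(1+κ)) + 4s(1+κ) + κ) ≤ ρ₀(1 − s(1+κ))`.  THEN `0 ≤ ε ≤ e` at every pin. [folklore] -/
theorem flow_nonneg_old_block_levels_of_cap_youngest
    (hmono : ∀ u v : ℕ → ℝ, SeqBox γ u → SeqBox γ v → (∀ j, u j ≤ v j) → B u ≤ B v)
    (hL : ∀ k, 0 ≤ L k) (hb : 0 < b) (hlo : ∀ u, SeqBox γ u → b ≤ B u) (hdom : ∀ u, SeqBox γ u → ∑ k ∈ range K, L k * u k ≤ B u)
    (hh : SeqBox γ h) (hf : MemFlow B gIR h) (hg : ∀ t, 0 < g t ∧ g t ≤ 1)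
    (hgF : ∀ t, 1 ≤ g t * (1 + ∑ k ∈ range K, L k * h (t + k) ^ 3 / 2)) (hK : 1 ≤ K)
    {κ s₀ s : ℝ} {R₀ ρ₀ Fm : ℕ} (hκ : 0 < κ) (hs : 0 ≤ s) (hsC : s * (1 + κ) < 1)
    (hR : κ + 4 * s * (1 + κ) ≤ (R₀ : ℝ) * (1 - s * (1 + κ)) * κ) (hρ2 : 2 ≤ ρ₀) (hρR : ρ₀ ≤ R₀)
    (hyoung : s₀ * ((ρ₀ : ℝ) * (1 - s * (1 + κ)) + (4 * s * (1 + κ) + κ)) ≤ (ρ₀ : ℝ) * (1 - s * (1 + κ)))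
    (hs38 : (3 : ℝ) < 8 * s ^ 2) (hsρ : 3 * (ρ₀ : ℝ) + 1 ≤ 8 * ρ₀ * s ^ 2)
    (hblock : ∀ (S : Finset ℕ) (lo hi q : ℕ), 56 ≤ lo → hi ≤ Fm * lo → hi < K → (∀ k ∈ S, lo ≤ k ∧ k ≤ hi) →
      ∑ k ∈ S, (k : ℝ) * (L k * h (q + k) ^ 3 / 2) ≤ s)
    {S₀ : Finset ℕ} {hi₀ : ℕ} (hS₀K : ∀ k ∈ S₀, 1 ≤ k ∧ k < K) (hS₀hi : ∀ k ∈ S₀, k ≤ hi₀) (hhi₀ : 1 ≤ hi₀)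
    (hcap0 : ∀ q, ∑ k ∈ S₀, (k : ℝ) * (L k * h (q + k) ^ 3 / 2) ≤ s₀)
    {r : ℕ} {T : ℕ → Finset ℕ} {a p : ℕ → ℕ} (hr : 1 ≤ r) (hap : ∀ j, 1 ≤ j → j < r → a j ≤ p j ∧ p j ≤ Fm * a j)
    (h56 : ∀ j, 1 ≤ j → j < r → a j < p j → 56 ≤ a j) (hpK : ∀ j, 1 ≤ j → j < r → p j < K)
    (hT : ∀ j, 1 ≤ j → j < r → ∀ k ∈ T j, a j ≤ k ∧ k ≤ p j)
    (hsep0 : 1 < r → ρ₀ * hi₀ ≤ a 1) (hsep : ∀ j, 1 ≤ j → j + 1 < r → R₀ * p j ≤ a (j + 1))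
    (hLa : ∀ l, l < K → l ∉ S₀ → (∀ j, 1 ≤ j → j < r → l ∉ T j) → L l = 0)
    {N : ℕ} {KL : ℕ → ℕ → ℕ → ℝ}
    (hKL : ∀ k n l, KL k n l = if 0 < k ∧ k < K ∧ l < k then L k * h (n + k) ^ 3 / 2 * ∏ t ∈ Ico (n + 1 + l) (n + k + 1), g t else 0)
    {KA : ℕ → ℕ → ℕ → ℝ} {RA : ℕ → (ℕ → ℝ) → ℕ → ℝ}
    (hRA : ∀ i v m, RA i v m = ∑ l ∈ range K, KA i m l * v (m + 1 + l))
    (hKA : ∀ i m l, KA i m l = KL i m l + KA (i + 1) m l) (hKAtop : ∀ m l, KA K m l = 0)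
    {e ε : ℕ → ℝ} (he0 : ∀ m, 0 ≤ e m) (hea : ∀ m, e (m + 1) ≤ e m)
    (hεt : ∀ m, N < m → ε m = 0) (hεrec : ∀ m, ε m = e m - RA 1 ε m) : ∀ m, 0 ≤ ε m ∧ ε m ≤ e m := by
  have hpos : ∀ n, 0 < h n := fun n => (hh n).1
  -- the window of each level and the chain of separations (ratio ≥ ρ₀ everywhere)
  obtain ⟨HI, hHI⟩ : ∃ HI : ℕ → ℕ, ∀ j, HI j = if j = 0 then hi₀ else p j := ⟨_, fun _ => rfl⟩
  have hHI0 : HI 0 = hi₀ := by rw [hHI]; simp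
  have hHIS : ∀ j, 1 ≤ j → HI j = p j := fun j hj => by rw [hHI, if_neg (by omega)]
  have hchain : ∀ i j, i < j → j < r → ρ₀ * HI i ≤ a j := by
    intro i j hij hjr
    induction j, hij using Nat.le_induction with
    | base =>
      rcases Nat.eq_zero_or_pos i with rfl | hi
      · rw [hHI0]; exact hsep0 (by omega)
      · rw [hHIS i hi]; exact le_trans (Nat.mul_le_mul_right _ hρR) (hsep i hi (by omega))
    | succ j hle ih =>
      have h1 := ih (by omega)
      have h2 := hsep j (by omega) hjr
      have h3 := (hap j (by omega) (by omega)).1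
      have h4 : ρ₀ * p j ≤ R₀ * p j := Nat.mul_le_mul_right _ hρR
      have h5 : p j ≤ ρ₀ * p j := Nat.le_mul_of_pos_left _ (by omega)
      omega
  have haρ : ∀ j, 1 ≤ j → j < r → ρ₀ ≤ a j := by
    intro j hj hjr
    have := hchain 0 j (by omega) hjr
    rw [hHI0] at this
    have : ρ₀ ≤ ρ₀ * hi₀ := Nat.le_mul_of_pos_right _ (by omega)
    omega
  refine flow_nonneg_cluster_levels_of_caps_youngest hmono hL hb hlo hdom hh hf hg hgF hK hκ hs hsC hR (by omega) hyoung
    (r := r) (S := fun j => if j = 0 then S₀ else T j) (lo := fun j => if j = 0 then 1 else a j) (hi := HI)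
    (fun j hj k hk => ?_) (fun j hj k hk => ?_) (fun j hj k hk => ?_) (fun j hj1 hjr => ?_) (fun h1r => ?_) (fun j hj1 hj => ?_)
    (fun i j hij hjr => ?_) (fun l hl hno => ?_) (fun q => ?_) (fun j q hj1 hjr => ?_) hKL hRA hKA hKAtop he0 hea hεt hεrec
  · -- members are ages in [1, K)
    by_cases hj0 : j = 0
    · subst hj0; simp only [if_true] at hk; exact hS₀K k hk
    · simp only [if_neg hj0] at hk
      have h1 := haρ j (by omega) hj; have h2 := hT j (by omega) hj k hk; have h3 := hpK j (by omega) hj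
      omega
  · -- members are ≥ lo
    by_cases hj0 : j = 0
    · subst hj0; simp only [if_true] at hk ⊢; exact (hS₀K k hk).1
    · simp only [if_neg hj0] at hk ⊢; exact (hT j (by omega) hj k hk).1
  · -- members are ≤ hi
    by_cases hj0 : j = 0
    · subst hj0; simp only [if_true] at hk; rw [hHI0]; exact hS₀hi k hk
    · simp only [if_neg hj0] at hk
      rw [hHIS j (by omega)]; exact (hT j (by omega) hj k hk).2
  · -- lo ≤ hi for the older levels
    simp only [if_neg (show j ≠ 0 by omega)]
    rw [hHIS j hj1]; exact (hap j hj1 hjr).1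
  · -- the youngest gap: ρ₀·hi₀ ≤ a 1
    simp only [if_neg (show (1 : ℕ) ≠ 0 by norm_num)]
    rw [hHI0]; exact hsep0 h1r
  · -- the older separations: R₀·p j ≤ a (j+1)
    simp only [if_neg (Nat.succ_ne_zero j)]
    rw [hHIS j hj1]; exact hsep j hj1 hj
  · -- the clusters are pairwise disjoint
    have hlt : ∀ x, x ∈ (if i = 0 then S₀ else T i) → ∀ y, y ∈ (if j = 0 then S₀ else T j) → x < y := by
      intro x hx y hy
      have hj0 : j ≠ 0 := by omega
      simp only [if_neg hj0] at hy
      have hc := hchain i j hij hjr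
      have hay : a j ≤ y := (hT j (by omega) hjr y hy).1
      have hxH : 1 ≤ x ∧ x ≤ HI i := by
        by_cases hi0 : i = 0
        · subst hi0; simp only [if_true] at hx; rw [hHI0]; exact ⟨(hS₀K x hx).1, hS₀hi x hx⟩
        · simp only [if_neg hi0] at hx
          rw [hHIS i (by omega)]
          have h1 := haρ i (by omega) (by omega); have h2 := hT i (by omega) (by omega) x hx
          omega
      have h6 : 2 * HI i ≤ ρ₀ * HI i := Nat.mul_le_mul_right _ hρ2
      omega
    exact disjoint_left.mpr fun x hx hx' => lt_irrefl x (hlt x hx x hx')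
  · -- the profile vanishes off the clusters
    refine hLa l hl (by simpa using hno 0 (by omega)) fun j hj1 hjr => ?_
    have := hno j hjr
    simp only [if_neg (show j ≠ 0 by omega)] at this
    exact this
  · -- the youngest cap
    simp only [if_true]; exact hcap0 q
  · -- the older caps: one age from ρ₀ on (the block sits inside {a j}), or a genuine block (the cap of the span)
    simp only [if_neg (show j ≠ 0 by omega)]
    have h2 := hap j hj1 hjr
    rcases h2.1.eq_or_lt with heq | hlt
    · have hsub : T j ⊆ {a j} := fun k hk => by
        have := hT j hj1 hjr k hk; rw [mem_singleton]; omega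
      have har : (ρ₀ : ℝ) ≤ a j := by exact_mod_cast haρ j hj1 hjr
      have haK : a j < K := by have := hpK j hj1 hjr; omega
      have hs0 : 0 < s := by nlinarith
      refine le_trans (sum_le_sum_of_subset_of_nonneg hsub fun k _ _ => ?_) ?_
      · have := hL k; have := hpos (q + k); positivity
      · rw [sum_singleton]
        refine load_le_of_sq hmono hL hb hlo hdom hh hf (by have := haρ j hj1 hjr; omega) haK hs0 ?_ q
        have h8 : 0 ≤ 8 * s ^ 2 - 3 := by linarith
        nlinarith [mul_le_mul_of_nonneg_right har h8]
    · exact hblock (T j) (a j) (p j) q (h56 j hj1 hjr hlt) h2.2 (hpK j hj1 hjr) (hT j hj1 hjr)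

/-! ## §2 Any young age at ratio 31 below a ×64 chain of old octaves -/

/-- **ANY YOUNG AGE AT RATIO 31 BELOW A ×64 CHAIN OF OLD OCTAVES, ANY NUMBER OF LEVELS.**  Profile carried by `{a₀} ∪ ⋃_{1≤j<r} T j` with `a₀ ≥ 1`
ARBITRARY, `T j ⊂ [a j, p j]` finite and arbitrary, `a j ≤ p j ≤ 2·a j` (`56 ≤ a j` whenever `a j < p j`), `31·a₀ ≤ a 1`, `64·p j ≤ a (j+1)`: `0 ≤ ε ≤ e`
at every pin, every horizon, every damping of the self-consistent class (`flow_nonneg_old_block_levels_of_cap_youngest` with `κ = 1∕5`, `s₀ = 0.7072`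
((E94b), any age), `s = 5∕8` ((E100b) `old_block_load_le`), `R₀ = 64`, `ρ₀ = 31`: `0.7072·(31·0.25 + 3.2) = 7.74384 ≤ 7.75`). [folklore] -/
theorem flow_nonneg_young_age_gap_old_blocks
    (hmono : ∀ u v : ℕ → ℝ, SeqBox γ u → SeqBox γ v → (∀ j, u j ≤ v j) → B u ≤ B v)
    (hL : ∀ k, 0 ≤ L k) (hb : 0 < b) (hlo : ∀ u, SeqBox γ u → b ≤ B u) (hdom : ∀ u, SeqBox γ u → ∑ k ∈ range K, L k * u k ≤ B u)
    (hh : SeqBox γ h) (hf : MemFlow B gIR h) (hg : ∀ t, 0 < g t ∧ g t ≤ 1)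
    (hgF : ∀ t, 1 ≤ g t * (1 + ∑ k ∈ range K, L k * h (t + k) ^ 3 / 2))
    {a₀ : ℕ} (ha0 : 1 ≤ a₀) (ha0K : a₀ < K)
    {r : ℕ} {T : ℕ → Finset ℕ} {a p : ℕ → ℕ} (hr : 1 ≤ r) (hap : ∀ j, 1 ≤ j → j < r → a j ≤ p j ∧ p j ≤ 2 * a j)
    (h56 : ∀ j, 1 ≤ j → j < r → a j < p j → 56 ≤ a j) (hpK : ∀ j, 1 ≤ j → j < r → p j < K)
    (hT : ∀ j, 1 ≤ j → j < r → ∀ k ∈ T j, a j ≤ k ∧ k ≤ p j)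
    (hsep0 : 1 < r → 31 * a₀ ≤ a 1) (hsep : ∀ j, 1 ≤ j → j + 1 < r → 64 * p j ≤ a (j + 1))
    (hLa : ∀ l, l < K → l ≠ a₀ → (∀ j, 1 ≤ j → j < r → l ∉ T j) → L l = 0)
    {N : ℕ} {KL : ℕ → ℕ → ℕ → ℝ}
    (hKL : ∀ k n l, KL k n l = if 0 < k ∧ k < K ∧ l < k then L k * h (n + k) ^ 3 / 2 * ∏ t ∈ Ico (n + 1 + l) (n + k + 1), g t else 0)
    {KA : ℕ → ℕ → ℕ → ℝ} {RA : ℕ → (ℕ → ℝ) → ℕ → ℝ}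
    (hRA : ∀ i v m, RA i v m = ∑ l ∈ range K, KA i m l * v (m + 1 + l))
    (hKA : ∀ i m l, KA i m l = KL i m l + KA (i + 1) m l) (hKAtop : ∀ m l, KA K m l = 0)
    {e ε : ℕ → ℝ} (he0 : ∀ m, 0 ≤ e m) (hea : ∀ m, e (m + 1) ≤ e m)
    (hεt : ∀ m, N < m → ε m = 0) (hεrec : ∀ m, ε m = e m - RA 1 ε m) : ∀ m, 0 ≤ ε m ∧ ε m ≤ e m := by
  refine flow_nonneg_old_block_levels_of_cap_youngest hmono hL hb hlo hdom hh hf hg hgF (by omega) (κ := 1 / 5) (s₀ := 7072 / 10000)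
    (s := 5 / 8) (R₀ := 64) (ρ₀ := 31) (Fm := 2) (by norm_num) (by norm_num) (by norm_num) (by norm_num) (by norm_num) (by norm_num) (by norm_num)
    (by norm_num) (by norm_num) (fun S lo hi q h1 h2 h3 h4 => old_block_load_le hmono hL hb hlo hdom hh hf h1 h2 h3 h4 q)
    (S₀ := {a₀}) (hi₀ := a₀) (fun k hk => ?_) (fun k hk => ?_) ha0 (fun q => ?_) hr hap h56 hpK hT hsep0 hsep (fun l hl hl0 hno => ?_)
    hKL hRA hKA hKAtop he0 hea hεt hεrec
  · rw [mem_singleton] at hk; subst hk; exact ⟨ha0, ha0K⟩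
  · rw [mem_singleton] at hk; omega
  · rw [sum_singleton]
    have ha0r : (1 : ℝ) ≤ a₀ := by exact_mod_cast ha0
    exact load_le_of_sq hmono hL hb hlo hdom hh hf ha0 ha0K (so := 7072 / 10000) (by norm_num) (by nlinarith) q
  · exact hLa l hl (fun h1 => hl0 (by rw [h1]; exact mem_singleton_self _)) hno

/-! ## §3 Two levels: the young cluster below ONE old octave, only the last-step closure -/

/-- **THE CENSUS YOUNG PAIR `{1, k₂}`, `2 ≤ k₂ ≤ 29`, BELOW ONE OLD OCTAVE AT GAP 34.**  Profile carried by `{1, k₂} ∪ T` with `T ⊂ [a, p]` finite and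
arbitrary, `a ≤ p ≤ 2a`, `34k₂ ≤ a`, `p < K`: `0 ≤ ε ≤ e` at every pin, every horizon, every damping of the self-consistent class ((E99g)
`flow_nonneg_two_cluster_levels_of_caps` with caps `0.8333` (E97c) and `5∕8` (E100b), `κ = 1∕1000`, `ρ₀ = 34`: `0.8333·(34·0.374375 + 2.5035) =
12.69304 ≤ 12.72875`; limit `ρ₀ ≥ 33.3`; the near-pair version (E99g) has `33`). [folklore] -/
theorem flow_nonneg_census_young_pair_one_old_block
    (hmono : ∀ u v : ℕ → ℝ, SeqBox γ u → SeqBox γ v → (∀ j, u j ≤ v j) → B u ≤ B v)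
    (hL : ∀ k, 0 ≤ L k) (hb : 0 < b) (hlo : ∀ u, SeqBox γ u → b ≤ B u) (hdom : ∀ u, SeqBox γ u → ∑ k ∈ range K, L k * u k ≤ B u)
    (hh : SeqBox γ h) (hf : MemFlow B gIR h) (hg : ∀ t, 0 < g t ∧ g t ≤ 1)
    (hgF : ∀ t, 1 ≤ g t * (1 + ∑ k ∈ range K, L k * h (t + k) ^ 3 / 2))
    {k₂ a p : ℕ} (hk2 : 2 ≤ k₂) (hk29 : k₂ ≤ 29) (hgap : 34 * k₂ ≤ a) (hap : a ≤ p) (hp2 : p ≤ 2 * a) (hpK : p < K)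
    {T : Finset ℕ} (hT : ∀ k ∈ T, a ≤ k ∧ k ≤ p)
    (hLa : ∀ l, l < K → l ≠ 1 → l ≠ k₂ → l ∉ T → L l = 0)
    {N : ℕ} {KL : ℕ → ℕ → ℕ → ℝ}
    (hKL : ∀ k n l, KL k n l = if 0 < k ∧ k < K ∧ l < k then L k * h (n + k) ^ 3 / 2 * ∏ t ∈ Ico (n + 1 + l) (n + k + 1), g t else 0)
    {KA : ℕ → ℕ → ℕ → ℝ} {RA : ℕ → (ℕ → ℝ) → ℕ → ℝ}
    (hRA : ∀ i v m, RA i v m = ∑ l ∈ range K, KA i m l * v (m + 1 + l))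
    (hKA : ∀ i m l, KA i m l = KL i m l + KA (i + 1) m l) (hKAtop : ∀ m l, KA K m l = 0)
    {e ε : ℕ → ℝ} (he0 : ∀ m, 0 ≤ e m) (hea : ∀ m, e (m + 1) ≤ e m)
    (hεt : ∀ m, N < m → ε m = 0) (hεrec : ∀ m, ε m = e m - RA 1 ε m) : ∀ m, 0 ≤ ε m ∧ ε m ≤ e m := by
  refine flow_nonneg_two_cluster_levels_of_caps hmono hL hb hlo hdom hh hf hg hgF (by omega) (κ := 1 / 1000) (s₀ := 8333 / 10000)
    (s := 5 / 8) (ρ₀ := 34) (by norm_num) (by norm_num) (by norm_num) (by norm_num) (by norm_num)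
    (S₀ := {1, k₂}) (S₁ := T) (hi₀ := k₂) (lo₁ := a) (hi₁ := p)
    (fun k hk => ?_) (fun k hk => ?_) (fun k hk => ?_) (fun k hk => (hT k hk).1) (fun k hk => (hT k hk).2) hap (by omega) (fun x hx y hy => ?_)
    (fun l hl h0 h1 => ?_) (fun q => ?_) (fun q => ?_) hKL hRA hKA hKAtop he0 hea hεt hεrec
  · simp only [mem_insert, mem_singleton] at hk; rcases hk with rfl | rfl <;> omega
  · simp only [mem_insert, mem_singleton] at hk; rcases hk with rfl | rfl <;> omega
  · have := hT k hk; omega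
  · simp only [mem_insert, mem_singleton] at hx
    have := hT y hy
    rcases hx with rfl | rfl <;> omega
  · refine hLa l hl (fun he => h0 ?_) (fun he => h0 ?_) h1
    · rw [he]; exact mem_insert_self _ _
    · rw [he]; exact mem_insert_of_mem (mem_singleton_self _)
  · rw [sum_pair (show (1 : ℕ) ≠ k₂ by omega), Nat.cast_one, one_mul]
    exact young_pair_load_le hmono hL hb hlo hdom hh hf hk2 hk29 (by omega) q
  · exact old_block_load_le hmono hL hb hlo hdom hh hf (by omega) hp2 hpK hT q

/-- **ANY YOUNG AGE BELOW ONE OLD OCTAVE AT GAP 17.**  Profile carried by `{a₀} ∪ T` with `a₀ ≥ 1` ARBITRARY, `T ⊂ [a, p]` finite and arbitrary,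
`56 ≤ a ≤ p ≤ 2a`, `17a₀ ≤ a`, `p < K`: `0 ≤ ε ≤ e` at every pin ((E99g) with caps `0.7072` (E94b) and `5∕8` (E100b), `κ = 1∕1000`, `ρ₀ = 17`:
`0.7072·(17·0.374375 + 2.5035) = 6.27136 ≤ 6.364375`; limit `ρ₀ ≥ 16.1`). [folklore] -/
theorem flow_nonneg_young_age_one_old_block
    (hmono : ∀ u v : ℕ → ℝ, SeqBox γ u → SeqBox γ v → (∀ j, u j ≤ v j) → B u ≤ B v)
    (hL : ∀ k, 0 ≤ L k) (hb : 0 < b) (hlo : ∀ u, SeqBox γ u → b ≤ B u) (hdom : ∀ u, SeqBox γ u → ∑ k ∈ range K, L k * u k ≤ B u)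
    (hh : SeqBox γ h) (hf : MemFlow B gIR h) (hg : ∀ t, 0 < g t ∧ g t ≤ 1)
    (hgF : ∀ t, 1 ≤ g t * (1 + ∑ k ∈ range K, L k * h (t + k) ^ 3 / 2))
    {a₀ a p : ℕ} (ha0 : 1 ≤ a₀) (hgap : 17 * a₀ ≤ a) (h56 : 56 ≤ a) (hap : a ≤ p) (hp2 : p ≤ 2 * a) (hpK : p < K)
    {T : Finset ℕ} (hT : ∀ k ∈ T, a ≤ k ∧ k ≤ p)
    (hLa : ∀ l, l < K → l ≠ a₀ → l ∉ T → L l = 0)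
    {N : ℕ} {KL : ℕ → ℕ → ℕ → ℝ}
    (hKL : ∀ k n l, KL k n l = if 0 < k ∧ k < K ∧ l < k then L k * h (n + k) ^ 3 / 2 * ∏ t ∈ Ico (n + 1 + l) (n + k + 1), g t else 0)
    {KA : ℕ → ℕ → ℕ → ℝ} {RA : ℕ → (ℕ → ℝ) → ℕ → ℝ}
    (hRA : ∀ i v m, RA i v m = ∑ l ∈ range K, KA i m l * v (m + 1 + l))
    (hKA : ∀ i m l, KA i m l = KL i m l + KA (i + 1) m l) (hKAtop : ∀ m l, KA K m l = 0)
    {e ε : ℕ → ℝ} (he0 : ∀ m, 0 ≤ e m) (hea : ∀ m, e (m + 1) ≤ e m)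
    (hεt : ∀ m, N < m → ε m = 0) (hεrec : ∀ m, ε m = e m - RA 1 ε m) : ∀ m, 0 ≤ ε m ∧ ε m ≤ e m := by
  have ha0K : a₀ < K := by omega
  refine flow_nonneg_two_cluster_levels_of_caps hmono hL hb hlo hdom hh hf hg hgF (by omega) (κ := 1 / 1000) (s₀ := 7072 / 10000)
    (s := 5 / 8) (ρ₀ := 17) (by norm_num) (by norm_num) (by norm_num) (by norm_num) (by norm_num)
    (S₀ := {a₀}) (S₁ := T) (hi₀ := a₀) (lo₁ := a) (hi₁ := p)
    (fun k hk => ?_) (fun k hk => ?_) (fun k hk => ?_) (fun k hk => (hT k hk).1) (fun k hk => (hT k hk).2) hap (by omega) (fun x hx y hy => ?_)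
    (fun l hl h0 h1 => ?_) (fun q => ?_) (fun q => ?_) hKL hRA hKA hKAtop he0 hea hεt hεrec
  · rw [mem_singleton] at hk; subst hk; exact ⟨ha0, ha0K⟩
  · rw [mem_singleton] at hk; omega
  · have := hT k hk; omega
  · rw [mem_singleton] at hx
    have := hT y hy; omega
  · exact hLa l hl (fun he => h0 (by rw [he]; exact mem_singleton_self _)) h1
  · rw [sum_singleton]
    have ha0r : (1 : ℝ) ≤ a₀ := by exact_mod_cast ha0
    exact load_le_of_sq hmono hL hb hlo hdom hh hf ha0 ha0K (so := 7072 / 10000) (by norm_num) (by nlinarith) q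
  · exact old_block_load_le hmono hL hb hlo hdom hh hf h56 hp2 hpK hT q

end Summit.QuantumFields.BalabanUV.Beta.EriceRemainderEnclosureHistoryAutonomyComparisonAgeCompositionOldBlockYoungestGap
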